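import Summits.MatrixMultiplication.OmegaCensus.GoldenClassCheck

/-!
# ω-census, family (b3): the groups `(ℤ[ζ₅]/p) ⋊ C₅` as a kernel-computable type (Schmidt atoms `A(p,5)` with `k = 4`: the INERT family)

HONEST FRAMING (pub-omega census; verbatim): lottery ticket; floor = certified bounds/negative ranges.
Census BOOKKEEPING (conjecture C9 of the cell; pub-omega stpp-1 gen 22).  For a prime `p ≡ ±2 (mod 5)` the Schmidt atom
`A(p,5) = 𝔽_{p⁴} ⋊ μ₅` (`ord₅ p = 4`) is `(ℤ[ζ₅]/p) ⋊ ζ`.  Model for EVERY `p`: the inner ring `Inn p = 𝔽_p[θ]/(θ² + θ − 1)`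
(`QuadraticAlgebra (ZMod p) 1 (−1)`, `θ = ⟨0,1⟩`, `θ² + θ = 1`) and `ZetaRing p = (Inn p)[ζ]/(ζ² − θζ + 1)`
(`QuadraticAlgebra (Inn p) (−1) θ`) `≅ ℤ[ζ₅]/p` of order `p⁴` with basis `1, θ, ζ, θζ`; `ζ⁵ = 1` from the generic computation
`QGold.gz_pow_five` (any commutative ring, `τ² + τ = 1`; the `ZMod p` case is `GoldenCyclic`); the group
`ZetaCyc p = RCyc (ZetaRing p) 5 ζ` of order `5p⁴`.  LATTICE CALCULUS on `ℤ⁴` (coordinates w.r.t. `1, θ, ζ, θζ`, to be divided by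
`2`): `ζ·(a, b, c, d) = (−c, −d, a + d, b + c − d)` (`lz4`, `gz_mul_toZ`), `ζ^s · v = lzpow4 s v` (`act_gz_toZ`).  With `α = A/2`
ALL products have coordinates `(integer)/2`: exact constant errors and phases `≡ error (mod 2)` independent of `p` — the 4-D
half-block construction of `ZetaBlocks.lean` / `ZetaCheck.lean`.  Nothing here is progress on `ω`.
-/

namespace Summit.MatrixMultiplication.OmegaCensus

/-! ### `ζ⁵ = 1` in `R[ζ]/(ζ² − τζ + 1)` for any commutative ring with `τ² + τ = 1` -/

namespace QGold

variable {R : Type*} [CommRing R] {τ : R}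

/-- `ζ`. [folklore] -/
def gz : QuadraticAlgebra R (-1) τ := ⟨0, 1⟩

/-- `ζ·(A + Bζ) = −B + (A + τB)ζ`. [folklore] -/
theorem gz_mul (A B : R) : gz * (⟨A, B⟩ : QuadraticAlgebra R (-1) τ) = ⟨-B, A + τ * B⟩ := by
  ext <;> simp [gz]

/-- `ζ² = −1 + τζ`. [folklore] -/
theorem gz_pow_two : (gz : QuadraticAlgebra R (-1) τ) ^ 2 = ⟨-1, τ⟩ := by
  rw [pow_two]
  ext <;> simp [gz]

/-- `ζ³ = −τ − τζ`. [folklore] -/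
theorem gz_pow_three (hτ : τ ^ 2 + τ = 1) : (gz : QuadraticAlgebra R (-1) τ) ^ 3 = ⟨-τ, -τ⟩ := by
  rw [pow_succ', gz_pow_two, gz_mul]
  ext
  · simp
  · simp only
    linear_combination hτ

/-- `ζ⁴ = τ − ζ`. [folklore] -/
theorem gz_pow_four (hτ : τ ^ 2 + τ = 1) : (gz : QuadraticAlgebra R (-1) τ) ^ 4 = ⟨τ, -1⟩ := by
  rw [pow_succ', gz_pow_three hτ, gz_mul]
  ext
  · simp
  · simp only
    linear_combination (-1 : R) * hτ

/-- **`ζ⁵ = 1`.** [folklore] -/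
theorem gz_pow_five (hτ : τ ^ 2 + τ = 1) : (gz : QuadraticAlgebra R (-1) τ) ^ 5 = 1 := by
  rw [pow_succ', gz_pow_four hτ, gz_mul]
  ext <;> simp [QuadraticAlgebra.re_one, QuadraticAlgebra.im_one]

end QGold

/-! ### The inner ring `𝔽_p[θ]`, `θ² + θ = 1`, and `ZetaRing p ≅ ℤ[ζ₅]/p` -/

/-- `𝔽_p[θ]/(θ² + θ − 1)` (`θ² = 1 − θ`). [folklore] -/
abbrev Inn (p : ℕ) : Type := QuadraticAlgebra (ZMod p) 1 (-1)

namespace Inn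

variable {p : ℕ}

/-- `θ`. [folklore] -/
def th : Inn p := ⟨0, 1⟩

/-- `θ² + θ = 1`. [folklore] -/
theorem th_sq : (th : Inn p) ^ 2 + th = 1 := by
  rw [pow_two]
  ext <;> simp [th, QuadraticAlgebra.re_one, QuadraticAlgebra.im_one]

/-- `Fact` form of `θ² + θ = 1`. [folklore] -/
instance fact_th_sq : Fact ((th : Inn p) ^ 2 + th = 1) := ⟨th_sq⟩

/-- `θ·(c + dθ) = d + (c − d)θ`. [folklore] -/
theorem th_mul (c d : ZMod p) : th * (⟨c, d⟩ : Inn p) = ⟨d, c - d⟩ := by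
  ext <;> simp [th]; ring

/-- `𝔽_p[θ]` is finite. [folklore] -/
instance [NeZero p] : Fintype (Inn p) := Fintype.ofEquiv _ (QuadraticAlgebra.equivProd (1 : ZMod p) (-1)).symm

/-- `|𝔽_p[θ]| = p²`. [folklore] -/
theorem card [NeZero p] : Fintype.card (Inn p) = p * p := by
  rw [Fintype.ofEquiv_card, Fintype.card_prod, ZMod.card]

end Inn

/-- `ℤ[ζ₅]/p` as `𝔽_p[θ][ζ]/(ζ² − θζ + 1)` (basis `1, θ, ζ, θζ`; the field `𝔽_{p⁴}` when `p ≡ ±2 (mod 5)`). [folklore] -/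
abbrev ZetaRing (p : ℕ) : Type := QuadraticAlgebra (Inn p) (-1) Inn.th

namespace ZetaRing

variable {p : ℕ}

/-- `ζ⁵ = 1` in `ℤ[ζ₅]/p` (`Fact`, group law of `ZetaCyc`). [folklore] -/
instance fact_gz_pow_five : Fact ((QGold.gz : ZetaRing p) ^ 5 = 1) := ⟨QGold.gz_pow_five Inn.th_sq⟩

/-- `ℤ[ζ₅]/p` is finite. [folklore] -/
instance [NeZero p] : Fintype (ZetaRing p) := Fintype.ofEquiv _ (QuadraticAlgebra.equivProd (-1 : Inn p) Inn.th).symm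

/-- `|ℤ[ζ₅]/p| = p⁴`. [folklore] -/
theorem card [NeZero p] : Fintype.card (ZetaRing p) = p * p * (p * p) := by
  rw [Fintype.ofEquiv_card, Fintype.card_prod, Inn.card]

end ZetaRing

/-- The group `(ℤ[ζ₅]/p) ⋊_ζ ℤ/5` of order `5p⁴` (the Schmidt atom `𝔽_{p⁴} ⋊ C₅` for `p ≡ ±2 (mod 5)`). [folklore] -/
abbrev ZetaCyc (p : ℕ) : Type := RCyc (ZetaRing p) 5 QGold.gz

/-- `|(ℤ[ζ₅]/p) ⋊ ℤ/5| = 5p⁴`. [folklore] -/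
theorem ZetaCyc.card (p : ℕ) [NeZero p] : Fintype.card (ZetaCyc p) = p * p * (p * p) * 5 := by
  rw [RCyc.card, ZetaRing.card]

/-! ### Lattice calculus on `ℤ⁴` -/

namespace ZetaArcs

/-- `ζ · (a + bθ + (c + dθ)ζ) = −(c + dθ) + ((a + d) + (b + c − d)θ)ζ` on coordinate vectors. [folklore] -/
def lz4 (v : ℤ × ℤ × ℤ × ℤ) : ℤ × ℤ × ℤ × ℤ := (-v.2.2.1, -v.2.2.2, v.1 + v.2.2.2, v.2.1 + v.2.2.1 - v.2.2.2)

/-- `ζ^k · v` on coordinate vectors. [folklore] -/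
def lzpow4 : ℕ → ℤ × ℤ × ℤ × ℤ → ℤ × ℤ × ℤ × ℤ
  | 0, v => v
  | k + 1, v => lz4 (lzpow4 k v)

variable {p : ℕ}

/-- The element of `ℤ[ζ₅]/p` with coordinates `v` scaled by `ι` (take `ι = 2⁻¹`). [folklore] -/
def toZ (ι : ZMod p) (v : ℤ × ℤ × ℤ × ℤ) : ZetaRing p :=
  ⟨⟨(v.1 : ZMod p) * ι, (v.2.1 : ZMod p) * ι⟩, ⟨(v.2.2.1 : ZMod p) * ι, (v.2.2.2 : ZMod p) * ι⟩⟩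

/-- **`ζ · toZ v = toZ (lz4 v)`.** [folklore] -/
theorem gz_mul_toZ (ι : ZMod p) (v : ℤ × ℤ × ℤ × ℤ) : QGold.gz * toZ ι v = toZ ι (lz4 v) := by
  rw [toZ, QGold.gz_mul, toZ, Inn.th_mul]
  ext <;> simp [lz4] <;> ring

/-- **`ζ^s · toZ v = toZ (lzpow4 s v)`** (the `RCyc` action). [folklore] -/
theorem act_gz_toZ (ι : ZMod p) (s : ZMod 5) (v : ℤ × ℤ × ℤ × ℤ) :
    RCyc.act QGold.gz s * toZ ι v = toZ ι (lzpow4 s.val v) := by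
  unfold RCyc.act
  induction s.val with
  | zero => rw [pow_zero, one_mul]; rfl
  | succ k ih => rw [pow_succ', mul_assoc, ih, gz_mul_toZ]; rfl

/-- Sanity check: `ζ⁵ = 1` on coordinate vectors. [folklore] -/
example : lzpow4 5 (1, 0, 0, 0) = (1, 0, 0, 0) := by decide

end ZetaArcs

end Summit.MatrixMultiplication.OmegaCensus
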